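import Mathlib
import HarnessLib
import Summits.HubbardSuperconductivity.HubbardSuperconductivity.Theorems.KLProgrammeKLRegimeWickKernelAntisymm

/-!
# Route `KLProgramme` — crux K3, ENGINE child (stmt-HubbardSuperconductivity-19918 `KLRegimeEngineV14`), (E2-v9): the FEYNMAN RULE FOR THE
# ONE-LINE (leg-dressing) TERM `Δ_×(C)(a⁰·b¹)` at a sorted leg colouring (cell gate-hubbard-kl, seat hubbard-kl-k3c2-p3 g3, row «leg-dress bar»)

E2-WICK-ROADMAP (p1) §1, class `𝒲₂⊗𝒲₄` with ONE slice line on an external leg = the (D) line `legDressBarQ·legSliceCountT` of the (E2-v9)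
budget.  The one-line part of the second-order Wick term is `Δ_×(g)(𝒲⁰𝒲¹)` folded (`klw_wickAction_succ_cross`, expanding
`(e^{Δ_×(g)} − 1)e^{Δ_×(D)} = Δ_×(g) + (two or more lines)`); its 4-leg kernel at labels `Z` is, by `kernel_dblFold`, the sum over the
`2⁴` colourings `s : Fin 4 → Fin 2`, and for EVEN `a, b` only the ODD colourings (`1+3` and `3+1` legs) survive — the dressed-leg graphs.
This file is the generic Feynman rule for those colourings, the one-line sibling of p1 g8's two-line rules
`constPart_bubble_colouring_1100/_0011` (…WickBubbleRule):

* **`constPart_oneLine_copyZero_copyOne`** — for ALL `a, b`, every covariance `C` and leg strings `X₀ : Fin m₀ → Γ` (read on copy `0`,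
  applied FIRST), `Y₁ : Fin m₁ → Γ` (copy `1`):
  `constPart (∂_{Ỹ₁} (∂_{X̃₀} (Δ_×(C)(a⁰·b¹)))) = (−1)^{m₀} · Σ_{X,Y} contr C X Y · constPart (∂_{X₀}∂_X a) · constPart (∂_{Y₁}∂_Y b)`
  (`grassmannLaplacian_crossCov_copy_mul_copy` + the mirror block rule `constPart_iterDeriv_copyZero_copyOne`; the sign `(−1)^{m₀}` is the
  parity twist `involute` of the single cross contraction passing the `m₀` copy-`0` derivatives);
* `constPart_oneLine_copyZero_copyOne_eq_zero_of_even` — if `a` is even and `m₀` is even (or `b` even and `m₁` even) the colouring vanishes;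
* the two sorted `1+3` / `3+1` readings of a 4-leg kernel, `constPart_oneLine_colouring_0111` / `constPart_oneLine_colouring_0001`
  (nested `iterDeriv` form, as the bubble rules), and `norm_constPart_oneLine_le` (the triangle-inequality form used by the (D) bound).

Generic (commutative `ℚ`-algebra / `RCLike` for the norm form, finite labels); proved; no definitions; nothing about the model is asserted.
-/

noncomputable section

namespace Summit.HubbardSuperconductivity.HubbardSuperconductivity.Theorems.KLRegimeWick

set_option linter.dupNamespace false -- summit = problem name (single-conjunct summit), D-0017

open Literature.MathematicalPhysics.QuantumLattice GrassmannAlgebra Finset Matrix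

section Generic

variable (R : Type*) [CommRing R] [Algebra ℚ R] {Γ : Type*} [Fintype Γ] [DecidableEq Γ]

omit [Fintype Γ] [DecidableEq Γ] [Algebra ℚ R] in
/-- Peeling off the LAST derivative: `∂_{X_m}∂_{X_{m-1}}⋯∂_{X_0} a = ∂_{X_m} (∂_{X_{m-1}}⋯∂_{X_0} a)`. -/
theorem iterDeriv_snoc_apply {Γ' : Type*} {m : ℕ} (X : Fin (m + 1) → Γ') (a : GrassmannAlgebra R Γ') :
    iterDeriv R X a = grassmannDeriv R (X (Fin.last m)) (iterDeriv R (fun i : Fin m => X i.castSucc) a) := by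
  rw [iterDeriv, iterDeriv, List.ofFn_succ', List.concat_eq_append, List.reverse_append, List.reverse_singleton,
    List.singleton_append, List.prod_cons, Module.End.mul_apply]

omit [Fintype Γ] [DecidableEq Γ] [Algebra ℚ R] in
/-- A single derivative: `iterDeriv ![X] = ∂_X`. -/
theorem iterDeriv_one_apply {Γ' : Type*} (X : Fin 1 → Γ') (a : GrassmannAlgebra R Γ') :
    iterDeriv R X a = grassmannDeriv R (X 0) a := by
  rw [iterDeriv_succ_apply, iterDeriv_zero_apply]

/-- **One-line Feynman rule** (copy-`0` legs `X₀` applied first, then copy-`1` legs `Y₁`): for ALL `a, b`,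
`constPart (∂_{Ỹ₁} (∂_{X̃₀} (Δ_×(C)(a⁰·b¹)))) = (−1)^{m₀} · Σ_{X,Y} contr C X Y · constPart (∂_{X₀}(∂_X a)) · constPart (∂_{Y₁}(∂_Y b))`. -/
theorem constPart_oneLine_copyZero_copyOne {m₀ m₁ : ℕ} (C : Matrix Γ Γ R) (a b : GrassmannAlgebra R Γ) (X₀ : Fin m₀ → Γ)
    (Y₁ : Fin m₁ → Γ) :
    constPart R (iterDeriv R (fun i => (Y₁ i, (1 : Fin 2)))
      (iterDeriv R (fun i => (X₀ i, (0 : Fin 2))) (grassmannLaplacian R (crossCov R C) (dblCopy R 0 a * dblCopy R 1 b)))) =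
      (-1 : R) ^ m₀ * ∑ X, ∑ Y, contr R C X Y *
        (constPart R (iterDeriv R X₀ (grassmannDeriv R X a)) * constPart R (iterDeriv R Y₁ (grassmannDeriv R Y b))) := by
  have key : ∀ (X Y : Γ),
      constPart R (iterDeriv R (fun i => (Y₁ i, (1 : Fin 2))) (iterDeriv R (fun i => (X₀ i, (0 : Fin 2)))
        (dblCopy R 0 (CliffordAlgebra.involute (grassmannDeriv R X a)) * dblCopy R 1 (grassmannDeriv R Y b)))) =
        (-1 : R) ^ m₀ * (constPart R (iterDeriv R X₀ (grassmannDeriv R X a)) * constPart R (iterDeriv R Y₁ (grassmannDeriv R Y b))) := by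
    intro X Y
    rw [constPart_iterDeriv_copyZero_copyOne R X₀ Y₁, iterDeriv_involute, map_smul, constPart_involute, smul_eq_mul]
    ring
  rw [grassmannLaplacian_crossCov_copy_mul_copy]
  simp only [map_sum, map_smul, smul_eq_mul, key, Finset.mul_sum]
  refine Finset.sum_congr rfl fun X _ => Finset.sum_congr rfl fun Y _ => ?_
  ring

/-- **Parity selection**: if `a` is EVEN and the number `m₀` of copy-`0` legs is EVEN, the colouring vanishes (the `a`-factor
`constPart (∂_{X₀}∂_X a)` reads an odd-degree component of an even element). -/
theorem constPart_oneLine_copyZero_copyOne_eq_zero_of_even_left {m₀ m₁ : ℕ} (C : Matrix Γ Γ R) {a : GrassmannAlgebra R Γ}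
    (ha : a ∈ evenOdd R (0 : ZMod 2)) (hm₀ : Even m₀) (b : GrassmannAlgebra R Γ) (X₀ : Fin m₀ → Γ) (Y₁ : Fin m₁ → Γ) :
    constPart R (iterDeriv R (fun i => (Y₁ i, (1 : Fin 2)))
      (iterDeriv R (fun i => (X₀ i, (0 : Fin 2))) (grassmannLaplacian R (crossCov R C) (dblCopy R 0 a * dblCopy R 1 b)))) = 0 := by
  rw [constPart_oneLine_copyZero_copyOne]
  have hz : ∀ X : Γ, constPart R (iterDeriv R X₀ (grassmannDeriv R X a)) = 0 := by
    intro X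
    have h1 : grassmannDeriv R X a ∈ evenOdd R (1 : ZMod 2) := by
      simpa using grassmannDeriv_mem_evenOdd R X ha
    have h2 : iterDeriv R X₀ (grassmannDeriv R X a) ∈ evenOdd R ((1 : ZMod 2) + m₀) := iterDeriv_mem_evenOdd R X₀ h1
    have h3 : ((1 : ZMod 2) + m₀) = 1 := by
      obtain ⟨k, hk⟩ := hm₀
      rw [hk]; push_cast; rw [← two_mul, show (2 : ZMod 2) = 0 from rfl, zero_mul, add_zero]
    rw [h3] at h2
    exact constPart_eq_zero_of_mem_evenOdd_one R h2
  simp only [hz, zero_mul, mul_zero, Finset.sum_const_zero]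

/-- The same on the other copy: `b` EVEN and `m₁` EVEN ⇒ the colouring vanishes. -/
theorem constPart_oneLine_copyZero_copyOne_eq_zero_of_even_right {m₀ m₁ : ℕ} (C : Matrix Γ Γ R) (a : GrassmannAlgebra R Γ)
    {b : GrassmannAlgebra R Γ} (hb : b ∈ evenOdd R (0 : ZMod 2)) (hm₁ : Even m₁) (X₀ : Fin m₀ → Γ) (Y₁ : Fin m₁ → Γ) :
    constPart R (iterDeriv R (fun i => (Y₁ i, (1 : Fin 2)))
      (iterDeriv R (fun i => (X₀ i, (0 : Fin 2))) (grassmannLaplacian R (crossCov R C) (dblCopy R 0 a * dblCopy R 1 b)))) = 0 := by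
  rw [constPart_oneLine_copyZero_copyOne]
  have hz : ∀ Y : Γ, constPart R (iterDeriv R Y₁ (grassmannDeriv R Y b)) = 0 := by
    intro Y
    have h1 : grassmannDeriv R Y b ∈ evenOdd R (1 : ZMod 2) := by
      simpa using grassmannDeriv_mem_evenOdd R Y hb
    have h2 : iterDeriv R Y₁ (grassmannDeriv R Y b) ∈ evenOdd R ((1 : ZMod 2) + m₁) := iterDeriv_mem_evenOdd R Y₁ h1
    have h3 : ((1 : ZMod 2) + m₁) = 1 := by
      obtain ⟨k, hk⟩ := hm₁
      rw [hk]; push_cast; rw [← two_mul, show (2 : ZMod 2) = 0 from rfl, zero_mul, add_zero]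
    rw [h3] at h2
    exact constPart_eq_zero_of_mem_evenOdd_one R h2
  simp only [hz, mul_zero, Finset.sum_const_zero]

/-- **Sorted `1+3` colouring of a 4-leg kernel** (leg `Z₀` on copy `0`, legs `Z₁,Z₂,Z₃` on copy `1`; the copy-`0` derivative applied first —
literally `iterDeriv ![(Z₀,0),(Z₁,1),(Z₂,1),(Z₃,1)]`):
`constPart (∂ (Δ_×(C)(a⁰b¹))) = −Σ_{X,Y} contr C X Y · constPart(∂_{[Z₀]}∂_X a) · constPart(∂_{[Z₁,Z₂,Z₃]}∂_Y b)`. -/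
theorem constPart_oneLine_colouring_0111 (C : Matrix Γ Γ R) (a b : GrassmannAlgebra R Γ) (Z₀ Z₁ Z₂ Z₃ : Γ) :
    constPart R (iterDeriv R ![(Z₀, (0 : Fin 2)), (Z₁, 1), (Z₂, 1), (Z₃, 1)]
      (grassmannLaplacian R (crossCov R C) (dblCopy R 0 a * dblCopy R 1 b))) =
      -∑ X, ∑ Y, contr R C X Y *
        (constPart R (iterDeriv R ![Z₀] (grassmannDeriv R X a)) * constPart R (iterDeriv R ![Z₁, Z₂, Z₃] (grassmannDeriv R Y b))) := by
  -- the label strings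
  have e1 : (fun i : Fin 3 => (![(Z₀, (0 : Fin 2)), (Z₁, 1), (Z₂, 1), (Z₃, 1)] : Fin 4 → Γ × Fin 2) i.succ) =
      fun i => ((![Z₁, Z₂, Z₃] : Fin 3 → Γ) i, (1 : Fin 2)) := by
    funext i; fin_cases i <;> rfl
  have e0 : (![(Z₀, (0 : Fin 2)), (Z₁, 1), (Z₂, 1), (Z₃, 1)] : Fin 4 → Γ × Fin 2) 0 = ((![Z₀] : Fin 1 → Γ) 0, (0 : Fin 2)) := rfl
  have hsplit : ∀ F : GrassmannAlgebra R (Γ × Fin 2),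
      iterDeriv R ![(Z₀, (0 : Fin 2)), (Z₁, 1), (Z₂, 1), (Z₃, 1)] F =
        iterDeriv R (fun i => ((![Z₁, Z₂, Z₃] : Fin 3 → Γ) i, (1 : Fin 2)))
          (iterDeriv R (fun i => ((![Z₀] : Fin 1 → Γ) i, (0 : Fin 2))) F) := by
    intro F
    rw [iterDeriv_succ_apply R ![(Z₀, (0 : Fin 2)), (Z₁, 1), (Z₂, 1), (Z₃, 1)] F, e1, e0, iterDeriv_one_apply]
  rw [hsplit, constPart_oneLine_copyZero_copyOne, pow_one, neg_one_mul]

/-- **Sorted `3+1` colouring of a 4-leg kernel** (legs `Z₀,Z₁,Z₂` on copy `0` applied first, leg `Z₃` on copy `1` — literally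
`iterDeriv ![(Z₀,0),(Z₁,0),(Z₂,0),(Z₃,1)]`):
`constPart (∂ (Δ_×(C)(a⁰b¹))) = −Σ_{X,Y} contr C X Y · constPart(∂_{[Z₀,Z₁,Z₂]}∂_X a) · constPart(∂_{[Z₃]}∂_Y b)`. -/
theorem constPart_oneLine_colouring_0001 (C : Matrix Γ Γ R) (a b : GrassmannAlgebra R Γ) (Z₀ Z₁ Z₂ Z₃ : Γ) :
    constPart R (iterDeriv R ![(Z₀, (0 : Fin 2)), (Z₁, 0), (Z₂, 0), (Z₃, 1)]
      (grassmannLaplacian R (crossCov R C) (dblCopy R 0 a * dblCopy R 1 b))) =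
      -∑ X, ∑ Y, contr R C X Y *
        (constPart R (iterDeriv R ![Z₀, Z₁, Z₂] (grassmannDeriv R X a)) * constPart R (iterDeriv R ![Z₃] (grassmannDeriv R Y b))) := by
  have e1 : (fun i : Fin 3 => (![(Z₀, (0 : Fin 2)), (Z₁, 0), (Z₂, 0), (Z₃, 1)] : Fin 4 → Γ × Fin 2) i.castSucc) =
      fun i => ((![Z₀, Z₁, Z₂] : Fin 3 → Γ) i, (0 : Fin 2)) := by
    funext i; fin_cases i <;> rfl
  have e3 : (![(Z₀, (0 : Fin 2)), (Z₁, 0), (Z₂, 0), (Z₃, 1)] : Fin 4 → Γ × Fin 2) (Fin.last 3) =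
      ((![Z₃] : Fin 1 → Γ) 0, (1 : Fin 2)) := rfl
  have hsplit : ∀ F : GrassmannAlgebra R (Γ × Fin 2),
      iterDeriv R ![(Z₀, (0 : Fin 2)), (Z₁, 0), (Z₂, 0), (Z₃, 1)] F =
        iterDeriv R (fun i => ((![Z₃] : Fin 1 → Γ) i, (1 : Fin 2)))
          (iterDeriv R (fun i => ((![Z₀, Z₁, Z₂] : Fin 3 → Γ) i, (0 : Fin 2))) F) := by
    intro F
    rw [iterDeriv_snoc_apply R ![(Z₀, (0 : Fin 2)), (Z₁, 0), (Z₂, 0), (Z₃, 1)] F, e1, e3, iterDeriv_one_apply]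
  rw [hsplit, constPart_oneLine_copyZero_copyOne]
  norm_num

end Generic

/-! ## The norm form (over `ℂ`) -/

section Norm

variable {Γ : Type*} [Fintype Γ] [DecidableEq Γ]

/-- **Triangle-inequality form of the one-line rule** (the shape the (D) bound consumes): for every sorted colouring,
`‖constPart (∂_{Ỹ₁}∂_{X̃₀} (Δ_×(C)(a⁰b¹)))‖ ≤ Σ_{X,Y} ‖contr C X Y‖ · ‖constPart(∂_{X₀}∂_X a)‖ · ‖constPart(∂_{Y₁}∂_Y b)‖`. -/
theorem norm_constPart_oneLine_le {m₀ m₁ : ℕ} (C : Matrix Γ Γ ℂ) (a b : GrassmannAlgebra ℂ Γ) (X₀ : Fin m₀ → Γ) (Y₁ : Fin m₁ → Γ) :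
    ‖constPart ℂ (iterDeriv ℂ (fun i => (Y₁ i, (1 : Fin 2)))
      (iterDeriv ℂ (fun i => (X₀ i, (0 : Fin 2))) (grassmannLaplacian ℂ (crossCov ℂ C) (dblCopy ℂ 0 a * dblCopy ℂ 1 b))))‖ ≤
      ∑ X, ∑ Y, ‖contr ℂ C X Y‖ *
        (‖constPart ℂ (iterDeriv ℂ X₀ (grassmannDeriv ℂ X a))‖ * ‖constPart ℂ (iterDeriv ℂ Y₁ (grassmannDeriv ℂ Y b))‖) := by
  rw [constPart_oneLine_copyZero_copyOne, norm_mul, norm_pow, norm_neg, norm_one, one_pow, one_mul]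
  refine (norm_sum_le _ _).trans (Finset.sum_le_sum fun X _ => (norm_sum_le _ _).trans (Finset.sum_le_sum fun Y _ => ?_))
  rw [norm_mul, norm_mul]

end Norm

end Summit.HubbardSuperconductivity.HubbardSuperconductivity.Theorems.KLRegimeWick

end
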